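import Summits.CriticalPhenomena.PercolationContinuityZ3.Theorems.PercNearOneGluingNoHeavyLowerTailQuantitativeS5MarginPositive
import Summits.CriticalPhenomena.PercolationContinuityZ3.Theorems.PercNearOneGluingNoHeavyLowerTailQuantitativeS5RankGainPositive
import Summits.CriticalPhenomena.PercolationContinuityZ3.Theorems.PercNearOneGluingNoHeavyLowerTailQuantitativeS5CritWitnesses
import Summits.CriticalPhenomena.PercolationContinuityZ3.Theorems.PercNearOneGluingNoHeavyLowerTailQuantitativeS5RankDichotomy
import HarnessLib

/-!
# The explicit general-`F` floor of (S5) is positive OFF the universality regime (row M2-R30 ⟹, non-pocket case)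

Support file (`--supports stmt-CriticalPhenomena-4575`), prover seat `prim-rate-mine-2` (lane prim-rate, constants-miner (c), BENCH rows
M2-R30 / M2-R35; `run/shared/lean/prim/prim-rate/prim-rate-mine-2/PROOFS.md` §P37).  No definitions, no named facts, no sorries; standard
axioms.

Row M2-R30 (MINED; Engine-C census n ≤ 6 full, n = 7 sample, 0 failures) conjectures that the explicit, size-free floor of the surplus-transfer
inequality (S5) for an ARBITRARY monotone functional `F ≥ 0` (the left side of `CSH.s5dMargin_ge_sum_rankGain_add_isolatedFloor_of_lt_one`,
`FLOOR_F(r) = Σ_{a ∈ T} (γ_a(F, r)·q_a + iso_a(F, r))`) is COMPLETE: `0 < s5dMargin w T r [] o v F ↔ ∃` a compatible tie-break `r'` with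
`0 < FLOOR_F(r')`.  The rank DICHOTOMY of row M2-R35 (`CSH.s5dMargin_nil_pos_of_adj` / `…_nonneg_of_forall_not_adj`) splits the rank tuples
`(T, o, v, r)` into the NON-POCKET regime — some relay `b ≠ x₁` (the `r`-minimal relay), joined to `x₁`, is adjacent to the observer's pocket
`K = comp_o(Γ − T − v)` — where (S5) is strict for every strictly compatible `F`, and the POCKET (universality) regime.  THIS FILE settles
row M2-R30 ⟹ on the non-pocket regime, at the given rank:

* `CSH.floor_pos_of_adj` — in the non-pocket regime, for every monotone `F ≥ 0` with which the injective rank `r` is strictly compatible,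
  `0 < FLOOR_F(r)`: the summand `γ_b·q_b` of the touching relay `b` is positive (`CSH.rankGain_pos_of_reachable_of_lt`: `b ⇝ x₁` and
  `m_{x₁} < m_b`; `CSH.avoidConst_pos_of_touching`: `o` attaches to `b` inside the pocket), all other summands are `≥ 0`
  (`CSH.isolatedFloor_term_nonneg`);
* `CSH.s5dMargin_nil_pos_and_floor_pos_of_adj` — hence margin AND floor are positive there (row M2-R30's equivalence holds with `r' = r`),
  so the completeness conjecture M2-R30 ⟹ is REDUCED to the pocket regime `∂_T K ⊆ {x₁}`.
[cite: KozmaNitzan2024, Conj. 4 (p. 32)] [cite: Harris1960, Lemma 4.1 (p. 16)] [cite: Grimmett1999, §2.2]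
-/

noncomputable section

namespace Summit.CriticalPhenomena.PercolationContinuityZ3.Theorems

open MeasureTheory Set Literature.Probability.LatticeModels Literature.Probability.Percolation
open scoped Classical

namespace CSH

variable {n : ℕ}

/-- **The explicit general-`F` floor of (S5) is positive in the non-pocket regime.**  Weights non-degenerate on the support `E`; `o ≠ v` off
`T`; `r` injective on `T` with minimal relay `x₁`; a pocket vertex `y` (joined to `o` by pairs of `E` inside `V ∖ (T ∪ {v})`) adjacent in `E` to a
relay `b ≠ x₁` that is joined to `x₁` in `(V, E)`; `F` monotone, nonnegative, and `r` strictly compatible with its means.  Then the left side of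
`CSH.s5dMargin_ge_sum_rankGain_add_isolatedFloor_of_lt_one` at `r` is positive (its summand `γ_b·q_b` is).  Row M2-R30 ⟹, non-pocket case.
[cite: KozmaNitzan2024, Conj. 4 (p. 32)] [cite: Harris1960, Lemma 4.1 (p. 16)] -/
theorem floor_pos_of_adj (w : Sym2 (Fin n) → unitInterval) (E : Set (Sym2 (Fin n)))
    (hE0 : ∀ f, f ∉ E → (w f : ℝ) = 0) (hE1 : ∀ f ∈ E, 0 < (w f : ℝ) ∧ (w f : ℝ) < 1)
    (T : Finset (Fin n)) (r : Fin n → ℕ) (hr : Set.InjOn r ↑T) (x₁ : Fin n) (hx : x₁ ∈ T) (hmin : ∀ t ∈ T, r x₁ ≤ r t)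
    (o v : Fin n) (hoT : o ∉ T) (hvT : v ∉ T) (hov : o ≠ v)
    (y b : Fin n) (hy : (openGraph {f | f ∈ E ∧ ∀ z ∈ f, z ∉ T ∧ z ≠ v}).Reachable o y) (hb : b ∈ T) (hbx : b ≠ x₁)
    (hyb : s(y, b) ∈ E) (hbx₁ : (openGraph E).Reachable b x₁)
    (F : Set (Fin n) → ℝ) (hF : ∀ S S' : Set (Fin n), S ⊆ S' → F S ≤ F S') (hF0 : ∀ S : Set (Fin n), 0 ≤ F S)
    (hstrict : ∀ a ∈ T, ∀ a' ∈ T, r a < r a' →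
      ∫ ω, F (openCluster ω a) ∂(prodBernoulli w) < ∫ ω, F (openCluster ω a') ∂(prodBernoulli w)) :
    0 < ∑ a ∈ T, (rankGain w T r F a * avoidConst w a ((↑(T.erase a) : Set (Fin n)) ∪ ({d | d ∈ ([] : List (Fin n))} ∪ {v})) o +
        (∏ e ∈ Finset.univ.filter (fun e : Sym2 (Fin n) => ∃ y ∈ (↑(T.filter (fun b => r b < r a)) : Set (Fin n)), y ∈ e), (1 - (w e : ℝ))) *
          ((∫ η in ((⋃ t ∈ (insert a (T.filter (fun b => r a < r b) ∪ ([] : List (Fin n)).toFinset)), openConn o t) ∪ openConn o v),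
              F {c | c = a ∨ ∃ e ∈ openEdgeCluster η a, c ∈ e}
              ∂(prodBernoulli fun e => if (∃ y ∈ (↑(T.filter (fun b => r b < r a)) : Set (Fin n)), y ∈ e) then (0 : unitInterval) else w e)) -
            (prodBernoulli fun e => if (∃ y ∈ (↑(T.filter (fun b => r b < r a)) : Set (Fin n)), y ∈ e) then (0 : unitInterval) else w e).real
                ((⋃ t ∈ (insert a (T.filter (fun b => r a < r b) ∪ ([] : List (Fin n)).toFinset)), openConn o t) ∪ openConn o v) *
              (∫ η, F {c | c = a ∨ ∃ e ∈ openEdgeCluster η a, c ∈ e}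
                ∂(prodBernoulli fun e => if (∃ y ∈ (↑(T.filter (fun b => r b < r a)) : Set (Fin n)), y ∈ e) then (0 : unitInterval) else w e)))) := by
  have hcompat : ∀ a ∈ T, ∀ a' ∈ T, r a < r a' →
      ∫ ω, F (openCluster ω a) ∂(prodBernoulli w) ≤ ∫ ω, F (openCluster ω a') ∂(prodBernoulli w) :=
    fun a ha a' ha' hlt => (hstrict a ha a' ha' hlt).le
  -- `m_{x₁} < m_b`: `x₁` is ranked strictly below `b`
  have hrx : r x₁ < r b := by
    rcases (hmin b hb).lt_or_eq with hlt | heq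
    · exact hlt
    · exact absurd (hr hx hb heq) (Ne.symm hbx)
  have hm : ∫ ω, F (openCluster ω x₁) ∂(prodBernoulli w) < ∫ ω, F (openCluster ω b) ∂(prodBernoulli w) := hstrict x₁ hx b hb hrx
  -- the summand `γ_b · q_b` is positive, every summand is nonnegative
  have hγ : 0 < rankGain w T r F b := rankGain_pos_of_reachable_of_lt w E hE0 hE1 T r F hr hcompat b x₁ hb hx hm hbx₁
  have hq : 0 < avoidConst w b ((↑(T.erase b) : Set (Fin n)) ∪ ({d | d ∈ ([] : List (Fin n))} ∪ {v})) o :=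
    avoidConst_pos_of_touching w E hE0 hE1 o v hov T hoT hvT b y hb hy hyb
  have hnn := fun a' (ha' : a' ∈ T) => isolatedFloor_term_nonneg w o v T r F hF hF0 hcompat a' ha'
  have hsingle := Finset.single_le_sum (fun a' ha' => add_nonneg (hnn a' ha').1 (hnn a' ha').2) hb
  have hterm : 0 < rankGain w T r F b * avoidConst w b ((↑(T.erase b) : Set (Fin n)) ∪ ({d | d ∈ ([] : List (Fin n))} ∪ {v})) o :=
    mul_pos hγ hq
  linarith [(hnn b hb).2]

/-- **Row M2-R30's equivalence holds in the non-pocket regime, with the given rank as the witness.**  Under the hypotheses of `floor_pos_of_adj`: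
`0 < s5dMargin w T r [] o v F` (row M2-R35, `CSH.s5dMargin_nil_pos_of_adj`) AND `0 < FLOOR_F(r)`; in particular
`0 < s5dMargin … F ↔ ∃ r'` injective, compatible, with `0 < FLOOR_F(r')` holds there (both sides true).  The completeness conjecture M2-R30 ⟹
is thereby reduced to the pocket regime of row M2-R35 (ii). [cite: KozmaNitzan2024, Conj. 4 (p. 32)] [cite: Harris1960, Lemma 4.1 (p. 16)] -/
theorem s5dMargin_nil_pos_and_floor_pos_of_adj (w : Sym2 (Fin n) → unitInterval) (E : Set (Sym2 (Fin n)))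
    (hE0 : ∀ f, f ∉ E → (w f : ℝ) = 0) (hE1 : ∀ f ∈ E, 0 < (w f : ℝ) ∧ (w f : ℝ) < 1)
    (T : Finset (Fin n)) (r : Fin n → ℕ) (hr : Set.InjOn r ↑T) (x₁ : Fin n) (hx : x₁ ∈ T) (hmin : ∀ t ∈ T, r x₁ ≤ r t)
    (o v : Fin n) (hoT : o ∉ T) (hvT : v ∉ T) (hov : o ≠ v)
    (y b : Fin n) (hy : (openGraph {f | f ∈ E ∧ ∀ z ∈ f, z ∉ T ∧ z ≠ v}).Reachable o y) (hb : b ∈ T) (hbx : b ≠ x₁)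
    (hyb : s(y, b) ∈ E) (hbx₁ : (openGraph E).Reachable b x₁)
    (F : Set (Fin n) → ℝ) (hF : ∀ S S' : Set (Fin n), S ⊆ S' → F S ≤ F S') (hF0 : ∀ S : Set (Fin n), 0 ≤ F S)
    (hstrict : ∀ a ∈ T, ∀ a' ∈ T, r a < r a' →
      ∫ ω, F (openCluster ω a) ∂(prodBernoulli w) < ∫ ω, F (openCluster ω a') ∂(prodBernoulli w)) :
    0 < s5dMargin w T r [] o v F ∧
      ∃ r' : Fin n → ℕ, Set.InjOn r' ↑T ∧
        (∀ a ∈ T, ∀ a' ∈ T, r' a < r' a' →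
          ∫ ω, F (openCluster ω a) ∂(prodBernoulli w) ≤ ∫ ω, F (openCluster ω a') ∂(prodBernoulli w)) ∧
        0 < ∑ a ∈ T, (rankGain w T r' F a * avoidConst w a ((↑(T.erase a) : Set (Fin n)) ∪ ({d | d ∈ ([] : List (Fin n))} ∪ {v})) o +
          (∏ e ∈ Finset.univ.filter (fun e : Sym2 (Fin n) => ∃ y ∈ (↑(T.filter (fun b => r' b < r' a)) : Set (Fin n)), y ∈ e),
              (1 - (w e : ℝ))) *
            ((∫ η in ((⋃ t ∈ (insert a (T.filter (fun b => r' a < r' b) ∪ ([] : List (Fin n)).toFinset)), openConn o t) ∪ openConn o v),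
                F {c | c = a ∨ ∃ e ∈ openEdgeCluster η a, c ∈ e}
                ∂(prodBernoulli fun e =>
                  if (∃ y ∈ (↑(T.filter (fun b => r' b < r' a)) : Set (Fin n)), y ∈ e) then (0 : unitInterval) else w e)) -
              (prodBernoulli fun e =>
                  if (∃ y ∈ (↑(T.filter (fun b => r' b < r' a)) : Set (Fin n)), y ∈ e) then (0 : unitInterval) else w e).real
                  ((⋃ t ∈ (insert a (T.filter (fun b => r' a < r' b) ∪ ([] : List (Fin n)).toFinset)), openConn o t) ∪ openConn o v) *
                (∫ η, F {c | c = a ∨ ∃ e ∈ openEdgeCluster η a, c ∈ e}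
                  ∂(prodBernoulli fun e =>
                    if (∃ y ∈ (↑(T.filter (fun b => r' b < r' a)) : Set (Fin n)), y ∈ e) then (0 : unitInterval) else w e)))) := by
  refine ⟨((s5dMargin_nil_pos_of_adj w E hE0 hE1 T r hr x₁ hx hmin o v hoT hvT hov y b hy hb hbx hyb hbx₁).2 F hF hstrict), r, hr,
    fun a ha a' ha' hlt => (hstrict a ha a' ha' hlt).le, ?_⟩
  exact floor_pos_of_adj w E hE0 hE1 T r hr x₁ hx hmin o v hoT hvT hov y b hy hb hbx hyb hbx₁ F hF hF0 hstrict

end CSH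

end Summit.CriticalPhenomena.PercolationContinuityZ3.Theorems

end
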